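import Literature.MathematicalPhysics.QuantumFieldTheory.Balaban1983to89.T4BoundaryRateFrame
import Literature.MathematicalPhysics.QuantumFieldTheory.Balaban1983to89.B7Prop6Bound
import Literature.Analysis.Calculus.ExpDuhamel
import Literature.MathematicalPhysics.QuantumLattice.LieTrotter

/-!
# T4BoundaryRateWord — §13k of `T4BoundaryRate`, a THIRD SATELLITE LEAF: WORD CONSTRAINTS WITH BACKGROUND LETTERS CONTAIN A CONVEX
LIE-ALGEBRA CORE — the NON-COMMUTATIVE face of §13i's «convexity bought by shrinking» (cell `pub-balaban`, T4-DAG §5 row T4-U3.E,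
spine estimate NE5, boundary-functional member — fan-out prover P3, lineage t4-ne5-p3 gen 11–12; [folklore] kernel mathematics in an
arbitrary complete normed real (§13k) / complex (§13l) algebra with `‖1‖ = 1`; nothing of the parent, of the collar or of the Frame
leaf is modified; v1.1 = v1 + §13l THE WORD FRAME appended in a fresh namespace block — every code token of v1 byte-identical, header
sentences added; v1.1.1 = DOCFIX of the §13l section docstring: the [B12] p. 305 clause re-quoted from the page image, with (172); no
code token changed; v1.2 = v1.1.1 + §13m SHARPNESS OF THE LETTER-CORE RADIUS appended in a further fresh namespace block — every code
token of v1.1.1 byte-identical, header sentences added; v1.2.1 = DOCFIX of this header: §13m's declaration count corrected to six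
theorems — cross-read C-ne5p1-19 D1; no code token changed).

WHY A THIRD SATELLITE.  The inclusion needs the tree's exponential bounds `Literature.Analysis.Calculus.norm_exp_sub_one_le`
(`‖exp a − 1‖ ≤ e^{‖a‖} − 1`) and `Literature.MathematicalPhysics.QuantumLattice.norm_exp_le` (`‖exp a‖ ≤ e^{‖a‖}`; both in any
complete normed algebra with `‖1‖ = 1`) and the ordered product `B7Prop6Bound.oprod`; none of the three modules is in the import cone
of `T4BoundaryRateFrame` (which imports the collar chain only), and that cone is left untouched: the three imports are added HERE,
below the Frame leaf, and nowhere else (`ExpDuhamel` and `LieTrotter` import Mathlib pieces and `HarnessLib` only, `B7Prop6Bound`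
only `Mathlib`).

HONEST FRAMING (T4-DAG PAGE 1; identical to the parent's).  The cell's T4 target is rung (B)+1: existence AND uniqueness of the
ε → 0 limit of Bałaban's unit-scale averaged loop expectations on a FIXED finite torus — strictly beyond ultraviolet stability,
NOT infinite volume, NOT a mass gap, NOT the Clay problem.  The boundary-functional member `T4BoundaryCarrier.NE5B` of the spine
estimate NE5 is a TWO-RUN statement and NOTHING OF IT IS PRINTED.  THIS MODULE IS ELEMENTARY BANACH-ALGEBRA ARITHMETIC about words
`(e^{A₀}u₀)⋯(e^{A_{k−1}}u_{k−1})` in letters `u_i` of norm `≤ 1` perturbed by exponentials of «Lie-algebra» letters `A_i`; it is NOT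
an encoding of Bałaban's spaces (2.34)–(2.39) of [III] p. 261 and claims NOTHING about their shape.  What it certifies is the exact
sense in which the device of `T4BoundaryRateFrame` §13i (`framePath_of_convexCore` / `marginCauchy_of_convexCore`: a CONVEX inner
core carrying the static inclusions suffices for a NON-CONVEX encoding) survives non-commutativity: the INCLUSION of a convex core
survives (this file), the SHARPNESS of the core's radius (`T4BoundaryRateFrame.logR_sharp`, commuting scalar layers) is not
asserted here, and whether print's margins `β2^{−(j−n)}` survive the radius loss is decided NOWHERE — not in print (ONE run), not
here.  NOT summit progress.

CONTENT [folklore].  For letters `u : ℕ → 𝔸` with `‖u i‖ ≤ 1` and `A : ℕ → 𝔸`: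
`norm_word_sub_background_le` — `‖(e^{A₀}u₀)⋯(e^{A_{k−1}}u_{k−1}) − u₀⋯u_{k−1}‖ ≤ exp(Σ_{i<k}‖A_i‖) − 1` (telescoping induction;
the step is `P′ − Q′ = (P − Q)(e^{A}u) + Q((e^{A} − 1)u)` with `‖e^{A}‖ ≤ e^{‖A‖}`, `‖Q‖ ≤ 1`); `norm_word_sub_one_le` — hence
`‖word − 1‖ ≤ ‖u₀⋯u_{k−1} − 1‖ + (e^{Σ‖A_i‖} − 1)`; `wordCore_convex` — the core `{A | Σ_{i<k}‖A_i‖ < c}` is CONVEX (strict sublevel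
set of a sum of seminorms); `wordCore_subset_wordDom` — if the background word is within `r₀ < r` of `1`, the core of radius
`log(1 + (r − r₀))` lies inside the word domain `{A | ‖word − 1‖ < r}`; `wordCore_subset_wordDom_one` — no background (`u ≡ 1`):
`Σ‖A_i‖ < log(1 + r) ⟹ ‖e^{A₀}⋯e^{A_{k−1}} − 1‖ < r`, whose case `k = 1`, `𝔸 = ℂ` is (up to the identification of Mathlib's
`NormedSpace.exp` on `ℂ` with `Complex.exp`, not restated here) the layer constraint of §13i's `plaqdisc` (inner radius
`logR = log(1 + r)`, there proved SHARP, and the domain proved NON-CONVEX for all radii, `plaqdisc_not_convex'`); `zero_mem_wordDom`.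
CONTENT OF §13l (gen 12) [folklore]: THE DEVICE APPLIED — a TOY word frame (pieces = indices `Fin (N+1)`, backgrounds = `k`-letter
words in Lie-algebra letters, translation chart, letter-sum layer seminorms and gauge, encoded domains = §13k's word domains) on
which `T4BoundaryRateFrame.framePath_of_convexCore` / `marginCauchy_of_convexCore`, fed with `wordCore_convex` and
`wordCore_subset_wordDom`, give §12f's `FramePath` and §11's `MarginCauchy` (`c₀ = 2`) under the toy's named WORD FIT
(`word_framePath`, `word_marginCauchy`); the negative control `wdom_one_not_convex` (NO word domain about the trivial background is
convex — any number of letters, any positive radius — by pull-back along a scalar line to §13i's `plaqdisc_not_convex'`), the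
sharpness of the fit for (F-E) of the cores (`word_core_frameEndMargin_iff`), non-vacuity (`word_framePath_inhabited`) and the
consistency with §13i for `𝔸 = ℂ` (`wordFrame_dom_complex`); see the §13l section docstring at the end of the file.
CONTENT OF §13m (gen 12) [folklore]: SHARPNESS OF THE LETTER-CORE RADIUS for the trivial background — `coreR 1 k r Y = log(1 + r Y)`
(`coreR_one`) and the letter-ℓ¹-ball of radius `c` about `0` lies inside the word domain of radius `ρ > 0` IFF `c ≤ log(1 + ρ)`
(`wcore_subset_wdom_one_iff`, `wordFrame_core_sharp`; any number `≥ 1` of letters, any complete complex normed algebra with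
`‖1‖ = 1`), tested on the real points `a·e₀` of the scalar line (`realPoint`, `norm_word_realPoint_sub_one`,
`realPoint_not_mem_wdom_one`) — the exact analogue of §13i's `logR_sharp`; with a non-trivial background nothing is asserted.

PRINT, FOR CONTEXT ONLY (quoted from the ×2 renders read as images by this lineage; no disputed step is used; the quotations locate
an ANALOGY and assert nothing).  [III] = [Balaban1988Convergent] p. 261 (render `1988-cmp119-convergent-renormalization-p019-x2.png`):
*"(i) 𝐔 = U′U, U has values in the group G"*, (2.34) *"|∂U − 1|, |∂𝐔 − 1| < (1 − β(1 − 2^{−(j−n)}))α_{0,n}ξ²(Lⁿξ)^{−2}"*, *"(iii)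
U′ = exp iξA′, A′ has values in the algebra 𝐠^c,"* (2.39) *"Lⁿξ|A′|, (Lⁿξ)²|∇^ξ_U A′| < (1 − β(1 − 2^{−(j−n)}))α_{1,n}"* — a
plaquette variable of `𝐔 = U′U` is a WORD in letters `exp iξA′(b)` and `U(b)` (the latter group-valued, of norm `1` in a unitary
representation), (2.39) a seminorm ball in the Lie-algebra field `A′`; and [B7] = [Balaban1985Averaging] p. 22 (render
`1985-cmp98-averaging-p006-x2.png`) prints the one-letter price: *"For matrices X satisfying |X − 1| ≦ ½, we have"* (26) *"|log X| ≦
Σ_{n=1}^{∞} (1/n)|X − 1|ⁿ ≦ |X − 1|/(1 − |X − 1|) ≦ 2|X − 1|"*, (27) *"|X − 1| = |e^{log X} − 1| ≦ e^{|log X|} − 1 ≦ e^{|log X|}|log X| ≦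
2|log X|"*.  The dictionary «`u_i` ↔ `U(b)`, `A_i` ↔ `iξA′(b)`, word ↔ `∂𝐔`, `r` ↔ the right side of (2.34), `r₀` ↔ `|∂U − 1|`» is an
ANALOGY: print's (2.34)–(2.35) also constrain AVERAGED configurations `U_{p,X}(M˙(𝐔))`, nonlinear in `𝐔`, and (2.39) bounds a
covariant derivative; nothing here encodes either.

ABSOLUTE RULE.  Every declaration is [folklore] (kernel-checked elementary analysis; tree lemmas used BY NAME:
`Literature.Analysis.Calculus.norm_exp_sub_one_le`, `Literature.MathematicalPhysics.QuantumLattice.norm_exp_le`, `B7Prop6Bound.oprod`;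
Mathlib: `convex_iff_forall_pos`, `norm_smul`,
`Real.exp_log`, `Real.exp_lt_exp`, `Real.add_one_le_exp`, `noncomm_ring`) or [bookkeeping] (the two set definitions); no `sorry`, no
axiom, no hypothesis of statement type; print appears in docstrings only, as CONTEXT.  Cell record `t4/T4-EST-U3-NE5B-P3.md` §16(h).
§13l (gen 12) additionally uses BY NAME the Frame leaf's `T4BoundaryRateFrame.framePath_of_convexCore`, `marginCauchy_of_convexCore`,
`withDom`, `plaqdisc`, `plaqdisc_not_convex'`, the collar's `CplxFrame` / `FramePath` / `FrameMargin` / `FrameEndMargin` /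
`FrameChart` / `FrameCore` / `FrameGauge` / `FrameAnalytic` / `MarginCauchy` / `LayerGauge`, the parent's `Generation` / `BTable` /
`cpart` / `FluctChart`, `T4BoundaryCarrier.Carriers`, and Mathlib's `Seminorm.of`, `NormedAlgebra.complexToReal`,
`Convex.is_linear_preimage`, `NormedSpace.algebraMap_exp_comm`, `Complex.exp_eq_exp_ℂ`, `norm_algebraMap'`, `Fin.sum_univ_eq_sum_range`,
`Finset.sum_eq_single`, `Finset.lt_inf'_iff`; its structures and `rfl`-lemmas are [bookkeeping], its theorems [folklore]; cell record
§17.  §13m (gen 12) uses BY NAME §13k's `oprod_one` / `wordCore_subset_wordDom_one`, §13l's `scalarLine` / `word_scalarLine` /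
`mem_wcore_iff` / `wordFrame_dom`, and Mathlib's `Real.exp_log`, `Complex.ofReal_exp`, `Complex.norm_real`, `norm_algebraMap'`; one
definition (`realPoint`) [bookkeeping], six theorems [folklore]; cell record §17(h).
[cite: Balaban1988Convergent, (2.34)–(2.39) p.261, (2.41) p.261; Balaban1985Averaging, (26)–(27) p.22; Balaban1987RG1, (3.4) p.270,
p.271, (3.14) p.272, p.273; Balaban1985Variational, §G (172) p.305]
-/

namespace Literature.MathematicalPhysics.QuantumFieldTheory.Balaban1983to89.T4BoundaryRateWord

open Finset NormedSpace B7Prop6Bound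

variable {𝔸 : Type*} [NormedRing 𝔸]

/-! ### §13k(a) Background words and the Lie-algebra core (no exponential yet) -/

/-- THE LIE-ALGEBRA CORE [bookkeeping]: letters `A` with `Σ_{i<k} ‖A_i‖ < c`. [folklore] -/
def wordCore (k : ℕ) (c : ℝ) : Set (ℕ → 𝔸) := {A | ∑ i ∈ range k, ‖A i‖ < c}

/-- `0` is in the core for `c > 0`. [folklore] -/
theorem zero_mem_wordCore (k : ℕ) {c : ℝ} (hc : 0 < c) : (0 : ℕ → 𝔸) ∈ wordCore k c := by
  simpa [wordCore] using hc

/-- The trivial background `u ≡ 1` is the word `1`. [folklore] -/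
theorem oprod_one (k : ℕ) : oprod (fun _ => (1 : 𝔸)) k = 1 := by
  induction k with
  | zero => rfl
  | succ n ih => simp only [oprod] at ih ⊢; rw [ih, one_mul]

section Background

variable [NormOneClass 𝔸]

/-- A word in letters of norm `≤ 1` has norm `≤ 1` (`‖1‖ = 1`). [folklore] -/
theorem norm_oprod_le_one (u : ℕ → 𝔸) (hu : ∀ i, ‖u i‖ ≤ 1) : ∀ k, ‖oprod u k‖ ≤ 1
  | 0 => by simp [oprod]
  | k + 1 => by
    simp only [oprod]
    calc ‖oprod u k * u k‖ ≤ ‖oprod u k‖ * ‖u k‖ := norm_mul_le _ _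
      _ ≤ 1 * 1 := mul_le_mul (norm_oprod_le_one u hu k) (hu k) (norm_nonneg _) zero_le_one
      _ = 1 := one_mul 1

end Background

section Core

variable [NormedAlgebra ℝ 𝔸]

/-- **THE CORE IS CONVEX** [folklore]: a strict sublevel set of the sum of seminorms `A ↦ Σ_{i<k} ‖A_i‖` (`convex_iff_forall_pos`,
`norm_smul`). -/
theorem wordCore_convex (k : ℕ) (c : ℝ) : Convex ℝ (wordCore (𝔸 := 𝔸) k c) := by
  rw [convex_iff_forall_pos]
  intro A hA B hB a b ha hb hab
  simp only [wordCore, Set.mem_setOf_eq] at hA hB ⊢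
  have hle : ∑ i ∈ range k, ‖(a • A + b • B) i‖ ≤ a * ∑ i ∈ range k, ‖A i‖ + b * ∑ i ∈ range k, ‖B i‖ := by
    rw [mul_sum, mul_sum, ← sum_add_distrib]
    refine sum_le_sum fun i _ => ?_
    rw [Pi.add_apply, Pi.smul_apply, Pi.smul_apply]
    calc ‖a • A i + b • B i‖ ≤ ‖a • A i‖ + ‖b • B i‖ := norm_add_le _ _
      _ = a * ‖A i‖ + b * ‖B i‖ := by rw [norm_smul, norm_smul, Real.norm_of_nonneg ha.le, Real.norm_of_nonneg hb.le]
  have h1 : a * ∑ i ∈ range k, ‖A i‖ < a * c := mul_lt_mul_of_pos_left hA ha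
  have h2 : b * ∑ i ∈ range k, ‖B i‖ < b * c := mul_lt_mul_of_pos_left hB hb
  calc ∑ i ∈ range k, ‖(a • A + b • B) i‖ ≤ _ := hle
    _ < a * c + b * c := add_lt_add h1 h2
    _ = c := by rw [← add_mul, hab, one_mul]

/-- THE WORD DOMAIN around a background word `u` [bookkeeping]: letters `A` with `‖(e^{A₀}u₀)⋯(e^{A_{k−1}}u_{k−1}) − 1‖ < r` —
the toy reading of a «plaquette variable of 𝐔 = U′U close to 1» constraint ([III] (2.34) p. 261, quoted in the header; ANALOGY,
CONTEXT only; no encoding of (2.34)–(2.39) is proposed). [cite: Balaban1988Convergent, (2.34) p.261] -/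
def wordDom (u : ℕ → 𝔸) (k : ℕ) (r : ℝ) : Set (ℕ → 𝔸) :=
  {A | ‖oprod (fun i => exp (A i) * u i) k - 1‖ < r}

end Core

/-! ### §13k(b) The background word bound and the inclusion of the core -/

section Exp

variable [NormedAlgebra ℝ 𝔸] [CompleteSpace 𝔸] [NormOneClass 𝔸]

/-- **THE BACKGROUND WORD BOUND** [folklore]: perturbing each letter `u_i` (`‖u_i‖ ≤ 1`) of a word by a left exponential factor
`exp(A_i)` moves the word by at most `e^{Σ‖A_i‖} − 1`:
`‖(e^{A₀}u₀)⋯(e^{A_{k−1}}u_{k−1}) − u₀⋯u_{k−1}‖ ≤ exp(Σ_{i<k} ‖A_i‖) − 1` — NON-COMMUTATIVE telescoping: the step is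
`P·(e^{A}u) − Q·u = (P − Q)(e^{A}u) + Q((e^{A} − 1)u)` (`noncomm_ring`) with `‖e^{A}u‖ ≤ e^{‖A‖}`, `‖Q‖ ≤ 1`,
`‖(e^{A} − 1)u‖ ≤ e^{‖A‖} − 1`. -/
theorem norm_word_sub_background_le (A u : ℕ → 𝔸) (hu : ∀ i, ‖u i‖ ≤ 1) :
    ∀ k, ‖oprod (fun i => exp (A i) * u i) k - oprod u k‖ ≤ Real.exp (∑ i ∈ range k, ‖A i‖) - 1
  | 0 => by simp [oprod]
  | k + 1 => by
    have ih := norm_word_sub_background_le A u hu k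
    simp only [oprod]
    set P := oprod (fun i => exp (A i) * u i) k
    set Q := oprod u k
    have hsplit : P * (exp (A k) * u k) - Q * u k = (P - Q) * (exp (A k) * u k) + Q * ((exp (A k) - 1) * u k) := by
      noncomm_ring
    have hQ : ‖Q‖ ≤ 1 := norm_oprod_le_one u hu k
    have hE : ‖exp (A k)‖ ≤ Real.exp ‖A k‖ := Literature.MathematicalPhysics.QuantumLattice.norm_exp_le ℝ (A k)
    have hE1 : ‖exp (A k) - 1‖ ≤ Real.exp ‖A k‖ - 1 := Literature.Analysis.Calculus.norm_exp_sub_one_le (A k)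
    have hEu : ‖exp (A k) * u k‖ ≤ Real.exp ‖A k‖ :=
      (norm_mul_le _ _).trans (by
        have := mul_le_mul hE (hu k) (norm_nonneg _) (Real.exp_pos _).le
        simpa using this)
    have hE1u : ‖(exp (A k) - 1) * u k‖ ≤ Real.exp ‖A k‖ - 1 :=
      (norm_mul_le _ _).trans (by
        have h0 : 0 ≤ Real.exp ‖A k‖ - 1 := by linarith [Real.add_one_le_exp ‖A k‖, norm_nonneg (A k)]
        have := mul_le_mul hE1 (hu k) (norm_nonneg _) h0
        simpa using this)
    have hS : 0 ≤ Real.exp (∑ i ∈ range k, ‖A i‖) - 1 := by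
      linarith [Real.add_one_le_exp (∑ i ∈ range k, ‖A i‖), sum_nonneg (fun i (_ : i ∈ range k) => norm_nonneg (A i))]
    rw [hsplit, sum_range_succ, Real.exp_add]
    calc ‖(P - Q) * (exp (A k) * u k) + Q * ((exp (A k) - 1) * u k)‖
        ≤ ‖(P - Q) * (exp (A k) * u k)‖ + ‖Q * ((exp (A k) - 1) * u k)‖ := norm_add_le _ _
      _ ≤ ‖P - Q‖ * ‖exp (A k) * u k‖ + ‖Q‖ * ‖(exp (A k) - 1) * u k‖ := add_le_add (norm_mul_le _ _) (norm_mul_le _ _)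
      _ ≤ (Real.exp (∑ i ∈ range k, ‖A i‖) - 1) * Real.exp ‖A k‖ + 1 * (Real.exp ‖A k‖ - 1) :=
          add_le_add (mul_le_mul ih hEu (norm_nonneg _) hS) (mul_le_mul hQ hE1u (norm_nonneg _) zero_le_one)
      _ = Real.exp (∑ i ∈ range k, ‖A i‖) * Real.exp ‖A k‖ - 1 := by ring

/-- … hence the WORD CONSTRAINT against `1`: `‖(e^{A₀}u₀)⋯(e^{A_{k−1}}u_{k−1}) − 1‖ ≤ ‖u₀⋯u_{k−1} − 1‖ + (e^{Σ‖A_i‖} − 1)`.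
[folklore] -/
theorem norm_word_sub_one_le (A u : ℕ → 𝔸) (hu : ∀ i, ‖u i‖ ≤ 1) (k : ℕ) :
    ‖oprod (fun i => exp (A i) * u i) k - 1‖ ≤ ‖oprod u k - 1‖ + (Real.exp (∑ i ∈ range k, ‖A i‖) - 1) := by
  have h1 := norm_word_sub_background_le A u hu k
  calc ‖oprod (fun i => exp (A i) * u i) k - 1‖
      = ‖(oprod (fun i => exp (A i) * u i) k - oprod u k) + (oprod u k - 1)‖ := by rw [sub_add_sub_cancel]
    _ ≤ ‖oprod (fun i => exp (A i) * u i) k - oprod u k‖ + ‖oprod u k - 1‖ := norm_add_le _ _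
    _ ≤ _ := by linarith

/-- **CONVEX CORE INSIDE THE WORD DOMAIN, NON-COMMUTATIVELY** [folklore]: if the background word is within `r₀ = ‖u₀⋯u_{k−1} − 1‖ < r`
of `1`, the (convex, `wordCore_convex`) core of radius `log(1 + (r − r₀))` lies inside the word domain of radius `r`.  This is the
pair of inputs `hconv` / `hsub` of `T4BoundaryRateFrame.framePath_of_convexCore` for an encoding whose domains are word domains —
the non-commutative face of `T4BoundaryRateFrame.polydisc_logR_subset` (there `k = 1`, `u ≡ 1`, commuting scalar layers, radius
SHARP; here only the inclusion, at the loss `log(1 + (r − r₀))` shared among the `k` letters). -/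
theorem wordCore_subset_wordDom (u : ℕ → 𝔸) (hu : ∀ i, ‖u i‖ ≤ 1) (k : ℕ) {r : ℝ}
    (hr0 : ‖oprod u k - 1‖ < r) :
    wordCore k (Real.log (1 + (r - ‖oprod u k - 1‖))) ⊆ wordDom u k r := by
  intro A hA
  simp only [wordCore, wordDom, Set.mem_setOf_eq] at hA ⊢
  have hpos : 0 < 1 + (r - ‖oprod u k - 1‖) := by linarith [norm_nonneg (oprod u k - 1)]
  have hexp : Real.exp (∑ i ∈ range k, ‖A i‖) < 1 + (r - ‖oprod u k - 1‖) := by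
    calc Real.exp (∑ i ∈ range k, ‖A i‖) < Real.exp (Real.log (1 + (r - ‖oprod u k - 1‖))) := Real.exp_lt_exp.mpr hA
      _ = 1 + (r - ‖oprod u k - 1‖) := Real.exp_log hpos
  have h1 := norm_word_sub_one_le A u hu k
  linarith

/-- No background (`u ≡ 1`): `Σ_{i<k}‖A_i‖ < log(1 + r) ⟹ ‖e^{A₀}⋯e^{A_{k−1}} − 1‖ < r` — [B7] (27)'s first inequality for a word of
`k` exponentials (p. 22, quoted in the header; CONTEXT). [folklore] [cite: Balaban1985Averaging, (27) p.22] -/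
theorem wordCore_subset_wordDom_one (k : ℕ) {r : ℝ} (hr : 0 < r) :
    wordCore k (Real.log (1 + r)) ⊆ wordDom (fun _ => (1 : 𝔸)) k r := by
  have h1 : ‖oprod (fun _ => (1 : 𝔸)) k - 1‖ = 0 := by rw [oprod_one, sub_self, norm_zero]
  have h2 := wordCore_subset_wordDom (fun _ => (1 : 𝔸)) (fun _ => by rw [norm_one]) k (r := r) (by rw [h1]; exact hr)
  rwa [h1, sub_zero] at h2

/-- The word domain is NOT EMPTY as soon as the background word is within `r` of `1`: it contains the core's centre `A = 0`.
[folklore] -/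
theorem zero_mem_wordDom (u : ℕ → 𝔸) (hu : ∀ i, ‖u i‖ ≤ 1) (k : ℕ) {r : ℝ} (hr0 : ‖oprod u k - 1‖ < r) :
    (0 : ℕ → 𝔸) ∈ wordDom u k r :=
  wordCore_subset_wordDom u hu k hr0 (zero_mem_wordCore k (Real.log_pos (by linarith)))

end Exp

end Literature.MathematicalPhysics.QuantumFieldTheory.Balaban1983to89.T4BoundaryRateWord

/-! ## §13l THE WORD FRAME — `framePath_of_convexCore` APPLIED (gen 12; appended in a fresh `namespace … end` block, so that the
v1 code above is byte-identical and its section variables are out of scope; `𝔸 : Type` because the carriers' background types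
`T4OutputRate.Carriers.BgA/BgB` live in `Type`)

THE TOY [bookkeeping].  Pieces = indices `Fin (N+1)` (`scale = id`, `d = 0`, every strictly older index a parent, zero kernels);
backgrounds of both runs = `k`-letter words `(Fin k → 𝔸) × Fin 2` in LIE-ALGEBRA LETTERS (the tag is §8's Re/Im reading);
`transport = id`; the fluctuation chart TRANSLATES the letters, `(A, i) ↦ (A + 𝒜, i)`, amplitudes `Σ_i ‖𝒜_i‖ ≤ s`, cores
`Σ_i ‖A_i‖ < c X`; the layer gauge and EVERY layer seminorm of the complex frame (§11h `CplxFrame`, `E = Fin k → 𝔸` a complex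
normed algebra, real structure `NormedAlgebra.complexToReal`) are the letter sum `Σ_i ‖·_i‖` (the layer index is IDLE: one
constraint per index, counted `Y + 1` times by §12a's layer sum); and the encoded domain of the index `Y` is §13k's WORD DOMAIN
`{A | ‖(e^{A₀}u₀)⋯(e^{A_{k−1}}u_{k−1}) − 1‖ < r Y}` about a background word of letters `‖u_i‖ ≤ 1`.  The toy's named smallness
binder is the WORD FIT `WordFits`: `c X + s + g X Y ≤ ℓ Y` for parents `Y < X`, at the CORE RADII `ℓ = coreR`,
`coreR Y = log(1 + (r Y − ‖u₀⋯u_{k−1} − 1‖))`.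

THE HOOK [folklore].  `word_framePath`: background letters of norm `≤ 1` whose word is within every radius, `0 ≤ s` and the word fit
at the core radii give §12f's `FramePath` FOR THE WORD FRAME ITSELF — by `T4BoundaryRateFrame.framePath_of_convexCore` with the
convex letter cores `wcore` (§13k's `wordCore_convex`) placed inside the NON-CONVEX word domains by §13k's NON-COMMUTATIVE inclusion
`wordCore_subset_wordDom` (`wcore_subset_dom`) and carrying the two static margins (`word_core_frameMargin`,
`word_core_frameEndMargin`); `word_marginCauchy`: hence §11's `MarginCauchy` with `c₀ = 2` for every two-run table that is, index by
index, the Re/Im part of ONE function complex-differentiable on the word domain (`WordAdmT`, the wording of (F-An)).  So the loop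
announced in v1's header is closed by a kernel instance: §13i's device («a convex inner core carrying the static inclusions suffices
for a non-convex encoding») composed with §13k's inclusion yields the frame conclusions for an encoding whose domains are word
constraints in non-commuting letters.  NEGATIVE CONTROL: `wdom_one_not_convex` / `wordFrame_dom_not_convex` — with no background
and any positive radius NO word domain (any number `≥ 1` of letters, any complex normed algebra with `‖1‖ = 1`) is convex: it pulls
back along the real-linear scalar line `v ↦ (algebraMap ℂ 𝔸 v, 0, …, 0)` to §13i's one-layer domain `{v | ‖e^{v} − 1‖ < ρ}`,
`plaqdisc_not_convex'`; so §12h's `framePath_of_convex` does NOT apply to the word frame and the device is what is used.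
SHARPNESS WITHIN THE TOY: `word_core_frameEndMargin_iff` — (F-E) of the letter cores is EXACTLY the fit (test words along the first
unit letter); the cores are not claimed to be the largest convex subsets of the word domains (§13i's `logR_sharp` has no analogue
here), so what (F-P) of the word frame costs may be less than the fit.  NON-VACUITY: `word_framePath_inhabited` (positive core
radius, amplitude bound and rooms from equal thirds of the least core radius), `zero_mem_wordFrame_dom`, `wordFits_thirds`.
CONSISTENCY WITH §13i: `wordFrame_dom_complex` — for `𝔸 = ℂ`, one letter, no background, the encoded domain IS `plaqdisc 0 _ 0`.

HONEST FRAMING (as v1's; NE5B, `TiltLip`, `OpDisc`, `KernelContracts` are NOT PRINTED and are untouched; NOT summit progress).  The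
toy is NOT an encoding of [III]'s spaces (2.34)–(2.39) p. 261 and decides nothing about their shape or about whether print's margins
survive the core-radius loss.  Two faces occur in print and the toy mixes them on purpose: analyticity in Lie-algebra letters on
sup-norm-small sets — [B12] = [Balaban1985Variational] §G p. 305 *"then it is an analytic function of B = 1/i log V′ and it
has an expansion as a power series in B"* and (172) *"|V′ − 1| < C₁ε₁, hence V′ = e^{iB′}, |B′| < 2C₁ε₁ on 𝔅_k,"* (render
`1985-cmp102-variational-background-p029-x2.png` of the cell's reference set READ AS AN IMAGE, gen 12; v1.1 had quoted the first
clause from the pdf text layer, which drops the prime of `V′` — corrected here), a CONVEX face (a sup-norm smallness of the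
Lie-algebra letters) — and spaces cut out by constraints on plaquette WORDS, (2.34) p. 261 (quoted in v1's header); the toy
takes letters of the first kind as coordinates and a constraint of the second kind as the domain, to exhibit
the one situation in which §13i's device, not §12h's convexity, is what applies.  The chart is AFFINE in the letters, as print's
interpolation is in its algebra-valued field — [I] = [Balaban1987RG1] (3.4) p. 270 *"U_j(exp iQ_j(ηt𝐇_k(B′))Ū^j_{k+1})"*, p. 271
*"Q_j(ηt𝐇_k(B′)) = B(t)"* (spans of the Frame leaf's header; ANALOGY, CONTEXT only) — the nonlinearity sitting in the word
constraint, not in the chart.  Every declaration below is [folklore] (kernel-checked elementary analysis) or [bookkeeping]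
(definitions and `rfl`-lemmas); print appears in docstrings only.
[cite: Balaban1988Convergent, (2.34) p.261, (2.41) p.261; Balaban1987RG1, (3.4) p.270, p.271, (3.14) p.272, p.273;
Balaban1985Variational, §G (172) p.305] -/

namespace Literature.MathematicalPhysics.QuantumFieldTheory.Balaban1983to89.T4BoundaryRateWord

open Finset NormedSpace B7Prop6Bound
open T4OutputRate T4BoundaryCarrier T4BoundaryRate T4BoundaryRateCollar T4BoundaryRateFrame

/-! ### §13l(a) The letters of a finite word as a sequence; the letter-sum seminorm -/

section Letters

variable {𝔸 : Type} [NormedRing 𝔸]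

/-- The letters of a `k`-letter word `A : Fin k → 𝔸` read as a sequence (`0` beyond `k`; `oprod … k` never reads those).
[bookkeeping] [folklore] -/
def seqOf {k : ℕ} (A : Fin k → 𝔸) : ℕ → 𝔸 := fun i => if h : i < k then A ⟨i, h⟩ else 0

/-- [bookkeeping] [folklore] -/
theorem seqOf_of_lt {k : ℕ} (A : Fin k → 𝔸) {i : ℕ} (h : i < k) : seqOf A i = A ⟨i, h⟩ := dif_pos h

/-- [bookkeeping] [folklore] -/
theorem seqOf_of_le {k : ℕ} (A : Fin k → 𝔸) {i : ℕ} (h : k ≤ i) : seqOf A i = 0 := dif_neg (not_lt.mpr h)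

/-- [bookkeeping] [folklore] -/
@[simp] theorem seqOf_coe {k : ℕ} (A : Fin k → 𝔸) (i : Fin k) : seqOf A i = A i := by
  rw [seqOf_of_lt A i.2]

/-- [bookkeeping] [folklore] -/
@[simp] theorem seqOf_zero (k : ℕ) : seqOf (0 : Fin k → 𝔸) = 0 := by
  funext i; unfold seqOf; split_ifs <;> rfl

/-- [bookkeeping] [folklore] -/
theorem seqOf_add {k : ℕ} (A B : Fin k → 𝔸) : seqOf (A + B) = seqOf A + seqOf B := by
  funext i; simp only [seqOf, Pi.add_apply]; split_ifs <;> simp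

/-- The letter sum of the sequence is the letter sum of the word. [bookkeeping] [folklore] -/
theorem sum_norm_seqOf {k : ℕ} (A : Fin k → 𝔸) : ∑ i ∈ range k, ‖seqOf A i‖ = ∑ i, ‖A i‖ := by
  rw [← Fin.sum_univ_eq_sum_range (fun i => ‖seqOf A i‖) k]
  exact sum_congr rfl fun i _ => by rw [seqOf_coe]

variable (𝔸) in
/-- THE LETTER CORE [bookkeeping]: `k`-letter words with letter sum `Σ_i ‖A_i‖ < c` — `wordCore` read on `Fin k → 𝔸`. [folklore] -/
def wcore (k : ℕ) (c : ℝ) : Set (Fin k → 𝔸) := {A | ∑ i, ‖A i‖ < c}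

/-- [bookkeeping] [folklore] -/
theorem mem_wcore_iff {k : ℕ} {c : ℝ} (A : Fin k → 𝔸) : A ∈ wcore 𝔸 k c ↔ seqOf A ∈ wordCore k c := by
  simp only [wcore, wordCore, Set.mem_setOf_eq, sum_norm_seqOf]

/-- [folklore] -/
theorem zero_mem_wcore (k : ℕ) {c : ℝ} (hc : 0 < c) : (0 : Fin k → 𝔸) ∈ wcore 𝔸 k c := by
  simpa [wcore] using hc

/-- A word whose letters from the second on are `1` is its first letter. [folklore] -/
theorem oprod_succ_of_tail {a : ℕ → 𝔸} (ha : ∀ i, 1 ≤ i → a i = 1) : ∀ k, oprod a (k + 1) = a 0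
  | 0 => by simp [oprod]
  | k + 1 => by rw [oprod, oprod_succ_of_tail ha k, ha (k + 1) (by omega), mul_one]

/-- THE CORE RADIUS of the index `Y` [bookkeeping]: `log(1 + (r Y − ‖u₀⋯u_{k−1} − 1‖))` — the radius at which §13k's
`wordCore_subset_wordDom` places the convex letter core inside the word domain of radius `r Y`. [folklore] -/
noncomputable def coreR (u : ℕ → 𝔸) (k : ℕ) (r : ℕ → ℝ) (Y : ℕ) : ℝ := Real.log (1 + (r Y - ‖oprod u k - 1‖))

/-- The core radius is POSITIVE as soon as the background word is within `r Y` of `1`. [folklore] -/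
theorem coreR_pos {u : ℕ → 𝔸} {k : ℕ} {r : ℕ → ℝ} {Y : ℕ} (h : ‖oprod u k - 1‖ < r Y) : 0 < coreR u k r Y := by
  unfold coreR
  exact Real.log_pos (by linarith)

end Letters

/-! ### §13l(b) The toy: word carriers, generation, the letter chart and gauge, the word frame, the fit -/

/-- THE WORD CARRIERS [bookkeeping]: pieces = indices `Fin (N+1)` (`scale = id`, `d = 0`), backgrounds of both runs = `k`-letter
words `(Fin k → 𝔸) × Fin 2` (letters in Lie-algebra coordinates and the Re/Im reading tag of §8), `transport = id`, one
fluctuation label.  A TOY: nothing of Bałaban's. [folklore] -/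
abbrev wordCarriers (𝔸 : Type) (k N : ℕ) : T4BoundaryCarrier.Carriers where
  Dom := Fin (N + 1)
  scale := fun X => (X : ℕ)
  d := fun _ => 0
  d_nonneg := fun _ => le_rfl
  BgA := (Fin k → 𝔸) × Fin 2
  BgB := (Fin k → 𝔸) × Fin 2
  gauge := fun _ _ => 0
  gauge_nonneg := fun _ _ => le_rfl
  transport := fun U => U
  Fl := Unit
  admFl := Set.univ

/-- The toy generation [bookkeeping]: every strictly older index is a parent, no E-parents, zero kernels. [folklore] -/
def wordGeneration (𝔸 : Type) (k N : ℕ) : Generation (wordCarriers 𝔸 k N) where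
  parents := fun X => Finset.univ.filter (fun Y => Y < X)
  parents_lt := fun X Y hY => (mem_filter.mp hY).2
  eparents := fun _ => ∅
  eparents_lt := fun _ _ h => by simp at h
  K := fun _ _ => 0
  K_nonneg := fun _ _ => le_rfl
  KE := fun _ _ => 0
  KE_nonneg := fun _ _ => le_rfl

/-- [bookkeeping] [folklore] -/
theorem word_mem_parents_iff {𝔸 : Type} {k N : ℕ} (X Y : Fin (N + 1)) :
    Y ∈ (wordGeneration 𝔸 k N).parents X ↔ Y < X := by
  simp [wordGeneration]

section WordFrame

variable {𝔸 : Type} [NormedRing 𝔸] [NormedAlgebra ℂ 𝔸]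

variable (𝔸) in
/-- THE LETTER-SUM SEMINORM `w ↦ Σ_i ‖w_i‖` on `Fin k → 𝔸` (complex scalars). [bookkeeping] [folklore] -/
noncomputable def l1Semi (k : ℕ) : Seminorm ℂ (Fin k → 𝔸) :=
  Seminorm.of (fun w => ∑ i, ‖w i‖)
    (fun x y => by
      rw [← sum_add_distrib]
      exact sum_le_sum fun i _ => norm_add_le _ _)
    (fun a x => by
      rw [mul_sum]
      exact sum_congr rfl fun i _ => by rw [Pi.smul_apply, norm_smul])

/-- [bookkeeping] [folklore] -/
@[simp] theorem l1Semi_apply (k : ℕ) (w : Fin k → 𝔸) : l1Semi 𝔸 k w = ∑ i, ‖w i‖ := rfl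

variable (𝔸) in
/-- **THE LETTER CHART** [bookkeeping]: amplitudes = letter vectors `𝒜` with `Σ_i ‖𝒜_i‖ ≤ s`, core of the step of index `X` =
words with letter sum `< c X`, and the chart TRANSLATES the letters, `(A, i) ↦ (A + 𝒜, i)` — AFFINE in the Lie-algebra letters, as
print's interpolation is in its algebra-valued field: [I] (3.4) p. 270 *"U_j(exp iQ_j(ηt𝐇_k(B′))Ū^j_{k+1})"*, p. 271
*"Q_j(ηt𝐇_k(B′)) = B(t)"* (ANALOGY; CONTEXT only; nothing of Bałaban's).  `chart X U 0 = U`. [cite: Balaban1987RG1, (3.4) p.270, p.271] -/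
def letterChart (k N : ℕ) (c : ℕ → ℝ) (s : ℝ) : FluctChart (wordCarriers 𝔸 k N) (Fin k → 𝔸) where
  supp := fun _ => {𝒜 | ∑ i, ‖𝒜 i‖ ≤ s}
  core := fun X => {U | ∑ i, ‖U.1 i‖ < c X}
  chart := fun _ U 𝒜 => (U.1 + 𝒜, U.2)
  zero := 0
  chart_zero := fun X U => by simp

variable (𝔸) in
/-- THE LETTER GAUGE [bookkeeping]: `dist n U′ U = Σ_i ‖U′_i − U_i‖` on every layer (the layer index is idle in this toy). [folklore] -/
noncomputable def letterGauge (k N : ℕ) : LayerGauge (wordCarriers 𝔸 k N) where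
  dist := fun _ U' U => ∑ i, ‖U'.1 i - U.1 i‖
  dist_nonneg := fun _ _ _ => sum_nonneg fun i _ => norm_nonneg _
  dist_self := fun _ _ => by simp

/-- **THE WORD FRAME** [bookkeeping]: `E = Fin k → 𝔸` (sup norm, `NormedSpace ℂ`), every layer seminorm the letter sum,
`pt z i = (z, i)`, displacement = the amplitude, and the encoded domain of the index `Y` THE WORD DOMAIN of radius `r Y` about the
background word `u₀⋯u_{k−1}`: `{A | ‖(e^{A₀}u₀)⋯(e^{A_{k−1}}u_{k−1}) − 1‖ < r Y}` (`wordDom`, §13k). [folklore] -/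
noncomputable def wordFrame (k N : ℕ) (u : ℕ → 𝔸) (r : ℕ → ℝ) :
    CplxFrame (wordCarriers 𝔸 k N) (Fin k → 𝔸) (Fin k → 𝔸) where
  semi := fun _ => l1Semi 𝔸 k
  pt := fun z i => (z, i)
  disp := fun _ _ 𝒜 => 𝒜
  dom := fun Y => {A | seqOf A ∈ wordDom u k (r Y)}

/-- [bookkeeping] [folklore] -/
theorem wordFrame_dom (k N : ℕ) (u : ℕ → 𝔸) (r : ℕ → ℝ) (Y : Fin (N + 1)) :
    (wordFrame k N u r).dom Y = {A | seqOf A ∈ wordDom u k (r Y)} := rfl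

/-- [bookkeeping] [folklore] -/
@[simp] theorem wordFrame_semi (k N : ℕ) (u : ℕ → 𝔸) (r : ℕ → ℝ) (n : ℕ) :
    (wordFrame k N u r).semi n = l1Semi 𝔸 k := rfl

/-- **THE WORD FIT** — the toy's NAMED SMALLNESS BINDER [bookkeeping]: for every parent `Y < X`, the step-`X` core radius plus the
amplitude bound plus the circles' room fits inside the CORE radius of the parent: `c X + s + g X Y ≤ ℓ Y` — the `k`-letter,
letter-sum analogue of §13a's `PathFits` (there per layer and multiplicative; here one sum over the letters, additive in the
Lie-algebra coordinates).  Asserted for nothing of Bałaban's ([I] p. 273 *"We assume also that ε₁ is so small that 𝐇_j(B(t)) satisfies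
(3.14) with 1/3α₂ on the right-hand side."* is the sentence it is the toy face of; CONTEXT only). [cite: Balaban1987RG1, (3.14) p.272, p.273] -/
def WordFits (N : ℕ) (c : ℕ → ℝ) (s : ℝ) (g : Fin (N + 1) → Fin (N + 1) → ℝ) (ℓ : ℕ → ℝ) : Prop :=
  ∀ X Y : Fin (N + 1), Y < X → c X + s + g X Y ≤ ℓ Y

/-- THE FIT IS INHABITED [folklore]: equal thirds `c ≡ s = g ≡ λ` of a budget `3λ ≤ ℓ Y` (`lam`) for every index. -/
theorem wordFits_thirds (N : ℕ) {lam : ℝ} {ℓ : ℕ → ℝ} (h : ∀ Y : Fin (N + 1), 3 * lam ≤ ℓ Y) :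
    WordFits N (fun _ => lam) lam (fun _ _ => lam) ℓ :=
  fun _ Y _ => by linarith [h Y]

/-! ### §13l(c) The frame shapes: (F-Ch), (F-Co), (F-G) by bookkeeping; (F-M), (F-E) OF THE LETTER CORES from the fit -/

/-- (F-Ch) ON THE WORD FRAME [folklore]: the chart is the translation by the displacement (`rfl`). -/
theorem word_frameChart (k N : ℕ) (u : ℕ → 𝔸) (r : ℕ → ℝ) (c : ℕ → ℝ) (s : ℝ) :
    FrameChart (wordFrame k N u r) (letterChart 𝔸 k N c s) :=
  fun _ _ _ _ _ _ => rfl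

/-- (F-Co) ON THE WORD FRAME [folklore]: every background is an encoded point. -/
theorem word_frameCore (k N : ℕ) (u : ℕ → 𝔸) (r : ℕ → ℝ) (c : ℕ → ℝ) (s : ℝ) :
    FrameCore (wordFrame k N u r) (letterChart 𝔸 k N c s) :=
  fun _ U _ => ⟨U.1, U.2, rfl⟩

/-- (F-G) ON THE WORD FRAME [folklore]: the letter gauge of the translated word IS the letter sum of the amplitude. -/
theorem word_frameGauge (k N : ℕ) (u : ℕ → 𝔸) (r : ℕ → ℝ) (c : ℕ → ℝ) (s : ℝ) :
    FrameGauge (wordFrame k N u r) (letterChart 𝔸 k N c s) (letterGauge 𝔸 k N) := by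
  intro X z i _ 𝒜 _ n
  show ∑ j, ‖𝒜 j‖ ≤ ∑ j, ‖(z + 𝒜) j - z j‖
  simp

/-- THE LETTER CORES ARE CONVEX [folklore] (§13k's `wordCore_convex` read on `Fin k → 𝔸`: the ℝ-structure is the restriction of
the complex one, `NormedAlgebra.complexToReal`). -/
theorem wcore_convex (k : ℕ) (c : ℝ) : Convex ℝ (wcore 𝔸 k c) := by
  rw [convex_iff_forall_pos]
  intro A hA B hB a b ha hb hab
  simp only [wcore, Set.mem_setOf_eq] at hA hB ⊢
  have hle : ∑ i, ‖(a • A + b • B) i‖ ≤ a * ∑ i, ‖A i‖ + b * ∑ i, ‖B i‖ := by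
    rw [mul_sum, mul_sum, ← sum_add_distrib]
    refine sum_le_sum fun i _ => ?_
    rw [Pi.add_apply, Pi.smul_apply, Pi.smul_apply]
    calc ‖a • A i + b • B i‖ ≤ ‖a • A i‖ + ‖b • B i‖ := norm_add_le _ _
      _ = a * ‖A i‖ + b * ‖B i‖ := by rw [norm_smul, norm_smul, Real.norm_of_nonneg ha.le, Real.norm_of_nonneg hb.le]
  have h1 : a * ∑ i, ‖A i‖ < a * c := mul_lt_mul_of_pos_left hA ha
  have h2 : b * ∑ i, ‖B i‖ < b * c := mul_lt_mul_of_pos_left hB hb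
  calc ∑ i, ‖(a • A + b • B) i‖ ≤ _ := hle
    _ < a * c + b * c := add_lt_add h1 h2
    _ = c := by rw [← add_mul, hab, one_mul]

/-- **(F-M) OF THE LETTER CORES FROM THE STATIC HALF OF THE FIT** [folklore]: a core word of the step `X` (letter sum `< c X`)
plus a vector of letter sum `≤ g X Y` has letter sum `< c X + g X Y ≤ ℓ Y`. -/
theorem word_core_frameMargin (k N : ℕ) (u : ℕ → 𝔸) (r : ℕ → ℝ) {c : ℕ → ℝ} {s : ℝ}
    {g : Fin (N + 1) → Fin (N + 1) → ℝ} {ℓ : ℕ → ℝ} (hs : 0 ≤ s) (hfit : WordFits N c s g ℓ) :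
    FrameMargin (withDom (wordFrame k N u r) (fun Y => wcore 𝔸 k (ℓ Y))) (wordGeneration 𝔸 k N)
      (letterChart 𝔸 k N c s) (fun X Y _ => g X Y) := by
  intro X Y hY z i hz w hw
  have hYX : Y < X := (word_mem_parents_iff X Y).1 hY
  have hz' : ∑ j, ‖z j‖ < c X := hz
  have hw' : ∑ j, ‖w j‖ ≤ g X Y := by simpa using hw 0 (by simp)
  show ∑ j, ‖(z + w) j‖ < ℓ Y
  have hle : ∑ j, ‖(z + w) j‖ ≤ ∑ j, ‖z j‖ + ∑ j, ‖w j‖ := by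
    rw [← sum_add_distrib]; exact sum_le_sum fun j _ => norm_add_le _ _
  linarith [hfit X Y hYX]

/-- **(F-E) OF THE LETTER CORES FROM THE FIT** [folklore]: the displaced core word `z + 𝒜` plus a vector of letter sum `≤ g X Y`
has letter sum `< c X + s + g X Y ≤ ℓ Y`. -/
theorem word_core_frameEndMargin (k N : ℕ) (u : ℕ → 𝔸) (r : ℕ → ℝ) {c : ℕ → ℝ} {s : ℝ}
    {g : Fin (N + 1) → Fin (N + 1) → ℝ} {ℓ : ℕ → ℝ} (hfit : WordFits N c s g ℓ) :
    FrameEndMargin (withDom (wordFrame k N u r) (fun Y => wcore 𝔸 k (ℓ Y))) (wordGeneration 𝔸 k N)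
      (letterChart 𝔸 k N c s) (fun X Y _ => g X Y) := by
  intro X z i hz 𝒜 h𝒜 Y hY w hw
  have hYX : Y < X := (word_mem_parents_iff X Y).1 hY
  have hz' : ∑ j, ‖z j‖ < c X := hz
  have h𝒜' : ∑ j, ‖𝒜 j‖ ≤ s := h𝒜
  have hw' : ∑ j, ‖w j‖ ≤ g X Y := by simpa using hw 0 (by simp)
  show ∑ j, ‖(z + 𝒜 + w) j‖ < ℓ Y
  have hle : ∑ j, ‖(z + 𝒜 + w) j‖ ≤ ∑ j, ‖z j‖ + ∑ j, ‖𝒜 j‖ + ∑ j, ‖w j‖ := by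
    rw [← sum_add_distrib, ← sum_add_distrib]
    exact sum_le_sum fun j _ => (norm_add_le _ _).trans (add_le_add (norm_add_le _ _) le_rfl)
  linarith [hfit X Y hYX]

/-- The letter sum of a real multiple of the first unit letter `a·(1, 0, …, 0)` is `|a|` (`‖1‖ = 1`). [folklore] -/
theorem sum_norm_smul_single [NormOneClass 𝔸] {k : ℕ} (hk : 0 < k) (a : ℝ) :
    ∑ i, ‖(a • (Pi.single ⟨0, hk⟩ 1 : Fin k → 𝔸)) i‖ = |a| := by
  rw [Finset.sum_eq_single ⟨0, hk⟩]
  · rw [Pi.smul_apply, Pi.single_eq_same, norm_smul, norm_one, mul_one, Real.norm_eq_abs]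
  · intro i _ hi
    rw [Pi.smul_apply, Pi.single_eq_of_ne hi, smul_zero, norm_zero]
  · intro h; exact absurd (Finset.mem_univ _) h

/-- **SHARPNESS: (F-E) OF THE LETTER CORES IS EXACTLY THE FIT** [folklore] (at least one letter, `‖1‖ = 1`, positive core radii
`c`, `0 ≤ s`, nonnegative rooms `g`): test (F-E) on the words `(c X − ε)·e₀`, amplitude `s·e₀`, room vector `g X Y·e₀` along the
first unit letter.  What the DEVICE costs on this toy is therefore the fit and nothing less; what (F-P) of the word encoding itself
costs may be less (the cores are not claimed to be the largest convex subsets of the word domains — compare §13i's `logR_sharp`,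
which has no analogue here). -/
theorem word_core_frameEndMargin_iff [NormOneClass 𝔸] {k : ℕ} (hk : 0 < k) (N : ℕ) (u : ℕ → 𝔸) (r : ℕ → ℝ)
    {c : ℕ → ℝ} {s : ℝ} {g : Fin (N + 1) → Fin (N + 1) → ℝ} {ℓ : ℕ → ℝ} (hc : ∀ j, 0 < c j) (hs : 0 ≤ s)
    (hg : ∀ X Y, 0 ≤ g X Y) :
    FrameEndMargin (withDom (wordFrame k N u r) (fun Y => wcore 𝔸 k (ℓ Y))) (wordGeneration 𝔸 k N)
      (letterChart 𝔸 k N c s) (fun X Y _ => g X Y) ↔ WordFits N c s g ℓ := by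
  refine ⟨fun hE X Y hYX => le_of_not_gt fun hlt => ?_, word_core_frameEndMargin k N u r⟩
  set e : Fin k → 𝔸 := Pi.single ⟨0, hk⟩ 1 with he
  set ε : ℝ := min (c X / 2) ((c X + s + g X Y - ℓ Y) / 2) with hε
  have hε0 : 0 < ε := lt_min (by linarith [hc X]) (by linarith)
  have hεc : ε ≤ c X / 2 := min_le_left _ _
  have hεd : ε ≤ (c X + s + g X Y - ℓ Y) / 2 := min_le_right _ _
  have hz : (wordFrame k N u r).pt ((c X - ε) • e) 0 ∈ (letterChart 𝔸 k N c s).core X := by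
    show ∑ i, ‖((c X - ε) • e) i‖ < c X
    rw [he, sum_norm_smul_single hk, abs_of_nonneg (by linarith [hc X])]
    linarith
  have h𝒜 : s • e ∈ (letterChart 𝔸 k N c s).supp X := by
    show ∑ i, ‖(s • e) i‖ ≤ s
    rw [he, sum_norm_smul_single hk, abs_of_nonneg hs]
  have hw : ∀ j ∈ range ((Y : ℕ) + 1),
      (withDom (wordFrame k N u r) (fun Y => wcore 𝔸 k (ℓ Y))).semi ((Y : ℕ) - j) (g X Y • e) ≤ g X Y := by
    intro j _
    show ∑ i, ‖(g X Y • e) i‖ ≤ g X Y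
    rw [he, sum_norm_smul_single hk, abs_of_nonneg (hg X Y)]
  have hmem := hE X ((c X - ε) • e) 0 hz (s • e) h𝒜 Y ((word_mem_parents_iff X Y).2 hYX) (g X Y • e) hw
  have hsum : ∑ i, ‖((c X - ε) • e + s • e + g X Y • e) i‖ < ℓ Y := hmem
  rw [← add_smul, ← add_smul, he, sum_norm_smul_single hk,
    abs_of_nonneg (by linarith [hc X, hg X Y])] at hsum
  linarith

/-- THE ADMISSIBLE ONE-TABLE CLASS ON THE WORD DOMAINS [bookkeeping]: for every index `Y` the table on encoded points is a real
component (`cpart`, §8) of ONE function complex differentiable on the word domain of radius `r Y` — the reading (F-An) of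
(2.41)(ii) p. 261 *"(ii) it has an extension to an analytic function on the space Ũ^c_j(X, α̃₀, α̃₁)"* (ANALOGY; CONTEXT only).
[cite: Balaban1988Convergent, (2.41) p.261] -/
def WordAdmT (k N : ℕ) (u : ℕ → 𝔸) (r : ℕ → ℝ) :
    (ℕ → ℝ) → BTable (wordCarriers 𝔸 k N) ((Fin k → 𝔸) × Fin 2) → Prop :=
  fun _ h => ∀ (Y : Fin (N + 1)) (a : Unit), ∃ hc : (Fin k → 𝔸) → ℂ,
    DifferentiableOn ℂ hc {A | seqOf A ∈ wordDom u k (r Y)} ∧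
      ∀ w ∈ {A : Fin k → 𝔸 | seqOf A ∈ wordDom u k (r Y)}, ∀ i : Fin 2, h Y (w, i) a = cpart i (hc w)

/-- (F-An) for the word frame is the class's own wording. [folklore] -/
theorem word_frameAnalytic (k N : ℕ) (u : ℕ → 𝔸) (r : ℕ → ℝ) (W : Set (ℕ → ℝ)) :
    FrameAnalytic (wordFrame k N u r) W (WordAdmT k N u r) :=
  fun _ _ _ hh Y a _ => hh Y a

/-! ### §13l(d) THE HOOK: (F-P) and `MarginCauchy` for the NON-CONVEX word encoding through its convex letter cores -/

section Hook

variable [CompleteSpace 𝔸] [NormOneClass 𝔸]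

/-- **THE LETTER CORE OF THE CORE RADIUS LIES INSIDE THE WORD DOMAIN** [folklore]: §13k's `wordCore_subset_wordDom` read on
`Fin k → 𝔸` — background letters `‖u_i‖ ≤ 1` whose word is within every radius, `‖u₀⋯u_{k−1} − 1‖ < r j` (the background itself
meets the word constraints, as print's `U` meets (2.34) *"|∂U − 1|, |∂𝐔 − 1| < (1 − β(1 − 2^{−(j−n)}))α_{0,n}ξ²(Lⁿξ)^{−2}"*;
ANALOGY, CONTEXT only). [cite: Balaban1988Convergent, (2.34) p.261] -/
theorem wcore_subset_dom (k N : ℕ) {u : ℕ → 𝔸} (hu : ∀ i, ‖u i‖ ≤ 1) {r : ℕ → ℝ} (hr : ∀ j, ‖oprod u k - 1‖ < r j)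
    (Y : Fin (N + 1)) : wcore 𝔸 k (coreR u k r Y) ⊆ (wordFrame k N u r).dom Y :=
  fun A hA => wordCore_subset_wordDom u hu k (hr Y) ((mem_wcore_iff A).1 hA)

/-- **(F-P) ON THE WORD FRAME — `framePath_of_convexCore` APPLIED** [folklore]: background letters `‖u_i‖ ≤ 1` whose word is
within every radius, `0 ≤ s`, and the word fit at the core radii `ℓ Y = log(1 + (r Y − ‖u₀⋯u_{k−1} − 1‖))` give §12f's path hypothesis for the word encoding (whose domains
are word constraints, not convex: `wdom_one_not_convex`), the gauge being the letter gauge: the CHORD `z + t𝒜` runs inside the convex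
letter cores (`wcore_convex`), which lie inside the word domains NON-COMMUTATIVELY (`wcore_subset_dom` = §13k's
`wordCore_subset_wordDom`), and carries the two margins there (`word_core_frameMargin`, `word_core_frameEndMargin`). -/
theorem word_framePath (k N : ℕ) {u : ℕ → 𝔸} (hu : ∀ i, ‖u i‖ ≤ 1) {r : ℕ → ℝ} (hr : ∀ j, ‖oprod u k - 1‖ < r j)
    {c : ℕ → ℝ} {s : ℝ} {g : Fin (N + 1) → Fin (N + 1) → ℝ} (hs : 0 ≤ s) (hfit : WordFits N c s g (coreR u k r)) :
    FramePath (wordFrame k N u r) (wordGeneration 𝔸 k N) (letterChart 𝔸 k N c s) (letterGauge 𝔸 k N)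
      (fun X Y _ => g X Y) :=
  framePath_of_convexCore (d := fun Y => wcore 𝔸 k (coreR u k r Y)) (word_frameGauge k N u r c s)
    (fun Y => wcore_subset_dom k N hu hr Y) (fun _ Y _ => wcore_convex k (coreR u k r Y))
    (word_core_frameMargin k N u r hs hfit) (word_core_frameEndMargin k N u r hfit)

/-- **`MarginCauchy` (`c₀ = 2`) FOR TABLES ANALYTIC ON THE WORD DOMAINS** [folklore]: `marginCauchy_of_convexCore` on the word
frame — (F-Ch)/(F-Co)/(F-G) by bookkeeping, the convex letter cores inside the word domains with their two margins from the fit,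
(F-An) the class's wording, positive rooms `g`. -/
theorem word_marginCauchy (k N : ℕ) {u : ℕ → 𝔸} (hu : ∀ i, ‖u i‖ ≤ 1) {r : ℕ → ℝ} (hr : ∀ j, ‖oprod u k - 1‖ < r j)
    {c : ℕ → ℝ} {s : ℝ} {g : Fin (N + 1) → Fin (N + 1) → ℝ} (hs : 0 ≤ s)
    (hg : ∀ X Y : Fin (N + 1), Y < X → 0 < g X Y) (hfit : WordFits N c s g (coreR u k r)) (W : Set (ℕ → ℝ)) (κ : ℝ) :
    MarginCauchy (wordGeneration 𝔸 k N) (letterChart 𝔸 k N c s) W κ (WordAdmT k N u r) (letterGauge 𝔸 k N)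
      (fun X Y _ => g X Y) 2 :=
  marginCauchy_of_convexCore (d := fun Y => wcore 𝔸 k (coreR u k r Y)) (word_frameChart k N u r c s)
    (word_frameCore k N u r c s) (word_frameGauge k N u r c s) (fun Y => wcore_subset_dom k N hu hr Y)
    (fun _ Y _ => wcore_convex k (coreR u k r Y)) (word_core_frameMargin k N u r hs hfit)
    (word_core_frameEndMargin k N u r hfit) (word_frameAnalytic k N u r W)
    fun X Y hY _ _ => hg X Y ((word_mem_parents_iff X Y).mp hY)

/-- The word domain contains the trivial word of letters `0` (background word within `r Y` of `1`). [folklore] -/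
theorem zero_mem_wordFrame_dom (k N : ℕ) {u : ℕ → 𝔸} (hu : ∀ i, ‖u i‖ ≤ 1) {r : ℕ → ℝ} {Y : Fin (N + 1)}
    (h : ‖oprod u k - 1‖ < r Y) : (0 : Fin k → 𝔸) ∈ (wordFrame k N u r).dom Y := by
  show seqOf (0 : Fin k → 𝔸) ∈ wordDom u k (r Y)
  rw [seqOf_zero]
  exact zero_mem_wordDom u hu k h

/-- **THE HOOK IS INHABITED WITH POSITIVE DATA** [folklore]: for a background word within every radius the core radii are positive,
and equal thirds of the least of them give a fit with positive core radius, amplitude bound and rooms — so `word_framePath` /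
`word_marginCauchy` bound something: the core contains `0`, the amplitude `0` is admissible, every room is positive. -/
theorem word_framePath_inhabited (k N : ℕ) {u : ℕ → 𝔸} (hu : ∀ i, ‖u i‖ ≤ 1) {r : ℕ → ℝ}
    (hr : ∀ j, ‖oprod u k - 1‖ < r j) :
    ∃ lam : ℝ, 0 < lam ∧
      FramePath (wordFrame k N u r) (wordGeneration 𝔸 k N) (letterChart 𝔸 k N (fun _ => lam) lam) (letterGauge 𝔸 k N)
        (fun _ _ _ => lam) := by
  set m : ℝ := Finset.univ.inf' ⟨0, Finset.mem_univ _⟩ (fun Y : Fin (N + 1) => coreR u k r Y) with hm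
  have hmpos : 0 < m := by
    rw [hm, Finset.lt_inf'_iff]
    exact fun Y _ => coreR_pos (hr Y)
  refine ⟨m / 3, by positivity, word_framePath k N hu hr (by positivity) (wordFits_thirds N fun Y => ?_)⟩
  have hle : m ≤ coreR u k r Y := Finset.inf'_le _ (Finset.mem_univ Y)
  linarith

end Hook

/-! ### §13l(e) Non-vacuity and the negative control: the fit is inhabited; the word domains are NOT convex -/

variable (𝔸) in
/-- THE SCALAR LINE through the first letter [bookkeeping]: `v ↦ (algebraMap ℂ 𝔸 (v 0), 0, …, 0)`. [folklore] -/
noncomputable def scalarLine (k : ℕ) (v : Fin 1 → ℂ) : Fin (k + 1) → 𝔸 :=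
  Pi.single 0 (algebraMap ℂ 𝔸 (v 0))

/-- It is real-linear. [folklore] -/
theorem isLinearMap_scalarLine (k : ℕ) : IsLinearMap ℝ (scalarLine 𝔸 k) := by
  constructor
  · intro v w
    simp only [scalarLine, Pi.add_apply, map_add, Pi.single_add]
  · intro a v
    simp only [scalarLine, Pi.smul_apply]
    rw [← Pi.single_smul]
    congr 1
    rw [← Complex.coe_smul, ← Complex.coe_smul, smul_eq_mul, Algebra.smul_def, map_mul]

/-- The word of the scalar line (no background) is the exponential of the scalar: `exp(algebraMap z)·1⋯1 = algebraMap (e^z)`. [folklore] -/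
theorem word_scalarLine (k : ℕ) (v : Fin 1 → ℂ) :
    oprod (fun i => exp (seqOf (scalarLine 𝔸 k v) i) * (1 : 𝔸)) (k + 1) = algebraMap ℂ 𝔸 (Complex.exp (v 0)) := by
  rw [oprod_succ_of_tail]
  · rw [mul_one, seqOf_of_lt _ (Nat.succ_pos k)]
    show exp (scalarLine 𝔸 k v 0) = _
    rw [scalarLine, Pi.single_eq_same, Complex.exp_eq_exp_ℂ, algebraMap_exp_comm]
  · intro i hi
    rw [mul_one]
    rcases lt_or_ge i (k + 1) with h | h
    · rw [seqOf_of_lt _ h]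
      show exp (scalarLine 𝔸 k v ⟨i, h⟩) = 1
      rw [scalarLine, Pi.single_eq_of_ne (by intro h'; rw [Fin.ext_iff] at h'; simp at h'; omega), exp_zero]
    · rw [seqOf_of_le _ h, exp_zero]

section Negative

variable [NormOneClass 𝔸]

/-- The scalar line pulls the word domain (no background, radius `ρ`) back to §13i's one-layer plaquette-like domain
`{v | ‖e^{v₀} − 1‖ < ρ}` (`‖algebraMap w‖ = ‖w‖`, `‖1‖ = 1`). [folklore] -/
theorem scalarLine_preimage (k : ℕ) (ρ : ℝ) :
    scalarLine 𝔸 k ⁻¹' {A : Fin (k + 1) → 𝔸 | seqOf A ∈ wordDom (fun _ => (1 : 𝔸)) (k + 1) ρ} =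
      plaqdisc 0 (fun _ _ => ρ) 0 := by
  ext v
  simp only [Set.mem_preimage, Set.mem_setOf_eq, wordDom, plaqdisc, word_scalarLine]
  rw [← map_one (algebraMap ℂ 𝔸), ← map_sub, norm_algebraMap']
  constructor
  · intro h m hm
    have hm0 : m = 0 := Subsingleton.elim (α := Fin 1) _ _
    subst hm0
    exact h
  · intro h
    exact h 0 (le_refl _)

/-- **THE WORD DOMAINS ARE NOT CONVEX** (no background, any number `k + 1 ≥ 1` of letters, EVERY radius `ρ > 0`) [folklore]: a convex
word domain would pull back along the real-linear scalar line to a convex one-layer plaquette-like domain, contradicting §13i's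
`plaqdisc_not_convex'` — so §12h's `framePath_of_convex` does NOT apply to the word encoding and §13i's device is what
`word_framePath` uses. -/
theorem wdom_one_not_convex (k : ℕ) {ρ : ℝ} (hρ : 0 < ρ) :
    ¬ Convex ℝ {A : Fin (k + 1) → 𝔸 | seqOf A ∈ wordDom (fun _ => (1 : 𝔸)) (k + 1) ρ} := by
  intro h
  have h1 := h.is_linear_preimage (isLinearMap_scalarLine (𝔸 := 𝔸) k)
  rw [scalarLine_preimage] at h1
  exact plaqdisc_not_convex' 0 (r := fun _ _ => ρ) (j := 0) (fun _ => hρ) 0 (le_refl _) h1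

/-- … in the frame's wording: with no background and positive radii NO encoded domain of the word frame is convex. [folklore] -/
theorem wordFrame_dom_not_convex (k N : ℕ) {r : ℕ → ℝ} (hr : ∀ j, 0 < r j) (Y : Fin (N + 1)) :
    ¬ Convex ℝ ((wordFrame (k + 1) N (fun _ => (1 : 𝔸)) r).dom Y) :=
  wdom_one_not_convex k (hr Y)

/-- **CONSISTENCY WITH §13i** [folklore]: for `𝔸 = ℂ`, one letter and no background the word frame's encoded domain of index `Y`
IS the one-layer plaquette-like domain `plaqdisc 0 (fun _ _ => r Y) 0 = {v | ‖e^{v₀} − 1‖ < r Y}` of the Frame leaf (the scalar line is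
then the identity of `Fin 1 → ℂ`; `NormedSpace.exp = Complex.exp`). -/
theorem wordFrame_dom_complex (N : ℕ) (r : ℕ → ℝ) (Y : Fin (N + 1)) :
    (wordFrame 1 N (fun _ => (1 : ℂ)) r).dom Y = plaqdisc 0 (fun _ _ => r Y) 0 := by
  have hid : ∀ v : Fin 1 → ℂ, scalarLine ℂ 0 v = v := fun v => by
    funext i
    have hi : i = 0 := Subsingleton.elim (α := Fin 1) _ _
    subst hi
    simp [scalarLine]
  ext v
  have h := Set.ext_iff.1 (scalarLine_preimage (𝔸 := ℂ) 0 (r Y)) v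
  rw [Set.mem_preimage, hid] at h
  exact h

end Negative

end WordFrame

end Literature.MathematicalPhysics.QuantumFieldTheory.Balaban1983to89.T4BoundaryRateWord

/-! ## §13m (gen 12) SHARPNESS OF THE LETTER-CORE RADIUS — trivial background [folklore]

v1's header leaves the sharpness of the letter core's radius open (*"the SHARPNESS of the core's radius (`logR_sharp`) is not
asserted here"*). Along the SCALAR LINE it is immediate and needs NO commutativity: with the trivial background `u ≡ 1` the
core radius is `coreR 1 k r Y = log(1 + r Y)` (`coreR_one`); the real point `log(1+ρ)·e₀` has letter sum EXACTLY
`log(1+ρ)` (`sum_norm_realPoint`) and its word `e^{log(1+ρ)}·1⋯1` lies at distance EXACTLY `ρ` from `1`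
(`norm_word_realPoint_sub_one`), hence OUTSIDE the word domain of radius `ρ` (`realPoint_not_mem_wdom_one`): NO letter-ℓ¹-ball
about `0` of radius larger than `log(1+ρ)` fits inside the word domain (`wcore_subset_wdom_one_iff`: `wcore 𝔸 (k+1) c ⊆
{seqOf A ∈ wordDom 1 (k+1) ρ} ↔ c ≤ log(1+ρ)`), for ANY number `k + 1 ≥ 1` of letters and ANY complete complex normed algebra
with `‖1‖ = 1`. So, for the trivial background, the letter core that `word_framePath` feeds to §13i's device is the LARGEST
ℓ¹-ball about `0` inside the word domain — the exact analogue of §13i's `logR_sharp`. With a NON-trivial background `u` the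
radius `log(1 + (r − ‖u₀⋯u_{k−1} − 1‖))` of §13k is a triangle-inequality worst case (attained for some backgrounds, e.g.
`u₀ = −1` with the other letters `1`, and not for others); nothing about it is asserted here. CONTEXT / ANALOGY exactly as in
§13l: a toy; NOTHING of Bałaban asserted; `NE5B`, `TiltLip`, `OpDisc`, `KernelContracts` untouched and NOT PRINTED.
-/

namespace Literature.MathematicalPhysics.QuantumFieldTheory.Balaban1983to89.T4BoundaryRateWord

open Finset NormedSpace B7Prop6Bound

section Sharp

variable {𝔸 : Type} [NormedRing 𝔸]

/-- With the trivial background the core radius is `log(1 + r Y)`. [folklore] -/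
theorem coreR_one (k : ℕ) (r : ℕ → ℝ) (Y : ℕ) : coreR (fun _ => (1 : 𝔸)) k r Y = Real.log (1 + r Y) := by
  unfold coreR
  rw [oprod_one, sub_self, norm_zero, sub_zero]

variable [NormedAlgebra ℂ 𝔸]

variable (𝔸) in
/-- THE REAL POINT `a·e₀` of the scalar line [bookkeeping]. [folklore] -/
noncomputable def realPoint (k : ℕ) (a : ℝ) : Fin (k + 1) → 𝔸 := scalarLine 𝔸 k (fun _ => (a : ℂ))

/-- Its letter sum is `|a|` (`‖1‖ = 1`). [folklore] -/
theorem sum_norm_realPoint [NormOneClass 𝔸] (k : ℕ) (a : ℝ) : ∑ i, ‖realPoint 𝔸 k a i‖ = |a| := by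
  rw [Finset.sum_eq_single (0 : Fin (k + 1))]
  · rw [realPoint, scalarLine, Pi.single_eq_same, norm_algebraMap', Complex.norm_real, Real.norm_eq_abs]
  · intro i _ hi
    rw [realPoint, scalarLine, Pi.single_eq_of_ne hi, norm_zero]
  · intro h; exact absurd (Finset.mem_univ _) h

/-- Its word (trivial background) is at distance EXACTLY `|e^a − 1|` from `1`. [folklore] -/
theorem norm_word_realPoint_sub_one [NormOneClass 𝔸] (k : ℕ) (a : ℝ) :
    ‖oprod (fun i => exp (seqOf (realPoint 𝔸 k a) i) * (1 : 𝔸)) (k + 1) - 1‖ = |Real.exp a - 1| := by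
  rw [realPoint, word_scalarLine, ← map_one (algebraMap ℂ 𝔸), ← map_sub, norm_algebraMap', ← Complex.ofReal_exp,
    ← Complex.ofReal_one, ← Complex.ofReal_sub, Complex.norm_real, Real.norm_eq_abs]

/-- **THE REAL POINT `log(1+ρ)·e₀` IS NOT IN THE WORD DOMAIN OF RADIUS `ρ`** (trivial background, `ρ > 0`; its word is at distance
exactly `ρ`). [folklore] -/
theorem realPoint_not_mem_wdom_one [NormOneClass 𝔸] (k : ℕ) {ρ : ℝ} (hρ : 0 < ρ) :
    seqOf (realPoint 𝔸 k (Real.log (1 + ρ))) ∉ wordDom (fun _ => (1 : 𝔸)) (k + 1) ρ := by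
  simp only [wordDom, Set.mem_setOf_eq, not_lt, norm_word_realPoint_sub_one,
    Real.exp_log (by linarith : (0 : ℝ) < 1 + ρ), add_sub_cancel_left, abs_of_pos hρ, le_refl]

/-- **SHARPNESS OF THE LETTER-CORE RADIUS** (trivial background, `k + 1 ≥ 1` letters, `ρ > 0`, complete `𝔸` with `‖1‖ = 1`)
[folklore]: the letter-ℓ¹-ball of radius `c` about `0` lies inside the word domain of radius `ρ` IFF `c ≤ log(1 + ρ)` — `⇐` is
§13k's `wordCore_subset_wordDom_one` (monotonicity in `c`), `⇒` tests the real points `a·e₀`, `a ↑ log(1+ρ)`. -/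
theorem wcore_subset_wdom_one_iff [CompleteSpace 𝔸] [NormOneClass 𝔸] (k : ℕ) {ρ : ℝ} (hρ : 0 < ρ) (c : ℝ) :
    wcore 𝔸 (k + 1) c ⊆ {A : Fin (k + 1) → 𝔸 | seqOf A ∈ wordDom (fun _ => (1 : 𝔸)) (k + 1) ρ} ↔
      c ≤ Real.log (1 + ρ) := by
  constructor
  · intro h
    refine le_of_not_gt fun hlt => ?_
    -- the real point `a·e₀` with `log(1+ρ) ≤ a < c`, `a := log(1+ρ)`, lies in the core but not in the domain
    have hmem : realPoint 𝔸 k (Real.log (1 + ρ)) ∈ wcore 𝔸 (k + 1) c := by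
      show ∑ i, ‖realPoint 𝔸 k (Real.log (1 + ρ)) i‖ < c
      rw [sum_norm_realPoint, abs_of_pos (Real.log_pos (by linarith))]
      exact hlt
    exact realPoint_not_mem_wdom_one k hρ (h hmem)
  · intro hc A hA
    have hA' : seqOf A ∈ wordCore (k + 1) (Real.log (1 + ρ)) := by
      have := (mem_wcore_iff A).1 hA
      simp only [wordCore, Set.mem_setOf_eq] at this ⊢
      exact lt_of_lt_of_le this hc
    exact wordCore_subset_wordDom_one (k + 1) hρ hA'

/-- The same for the word frame's encoded domain: with the trivial background, the letter core of radius `coreR` used by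
`word_framePath` is the LARGEST letter-ℓ¹-ball about `0` inside `(wordFrame (k+1) N 1 r).dom Y`. [folklore] -/
theorem wordFrame_core_sharp [CompleteSpace 𝔸] [NormOneClass 𝔸] (k N : ℕ) {r : ℕ → ℝ} (hr : ∀ j, 0 < r j)
    (Y : Fin (N + 1)) (c : ℝ) :
    wcore 𝔸 (k + 1) c ⊆ (wordFrame (k + 1) N (fun _ => (1 : 𝔸)) r).dom Y ↔ c ≤ coreR (fun _ => (1 : 𝔸)) (k + 1) r Y := by
  rw [coreR_one, wordFrame_dom]
  exact wcore_subset_wdom_one_iff k (hr Y) c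

end Sharp

end Literature.MathematicalPhysics.QuantumFieldTheory.Balaban1983to89.T4BoundaryRateWord
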